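import Literature.NumberTheory.LFunctions.LagariasXiStructureFunctionProofs
import Literature.NumberTheory.LFunctions.SuzukiWeilModelSpace
import HarnessLib

/-!
# Suzuki's Weil–Hilbert-space chain: the RELATIONAL hat value `HasHatValueR` (removable-singularity form of clause 2 of
# `HasHatValue`) and `Θ_ξ` at the zero parameters of `A`

Statement-audit repair V29 of the rh-split cell (card `run/shared/lean/pub/rh-split/cards/SPLIT-dbr-neg.md` §14.4; seat
rh-split-dbr-neg g6, file `SketchG6d.lean` sha16 bb8ce175b926b4be; referee rh-split-ref g3 replay #4 2026-08-27T05:55:12Z: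
CONTENT + BYTES PASS, clauses 1/3 character-identical to `SuzukiWeilHilbertSpaceDefs.HasHatValue`, clause 2 = the card's 14.4 text;
lead rh-split-lead g3 RULINGS #25 «V29 = SUPERSEDE, NOT PATCH» and #28 «ONE Literature module»; filed by rh-split-typer-1 g4).

The tree's `HasHatValue ψ γ c` (`SuzukiWeilHilbertSpaceDefs`) evaluates clause 2 (`Im γ < 0`) through `Θ_ξ(γ)·conj((𝖪ψ)^(γ̄))`,
which at a ZERO PARAMETER of `E_ξ` (equivalently of `A = ξ(½ − iz)`, a multiple off-line zero) returns Lean's `0/0 = 0` instead of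
the printed value `−conj((𝖪ψ)^(γ̄))` ([Su23b] §3.2 p. 7: `ψ̂(γ) = Θ(γ)·conj φ̂(γ̄)` with `Θ = −1` at the zeros of `A`).  This module
SUPERSEDES rather than edits it (≈ 60 use sites stay untouched):
* (v-1) six RH-FREE facts: `tendsto_lagariasTheta_neg_one_of_lagariasXiA_eq_zero` (`Θ_ξ → −1` at every zero parameter of `A`,
  any multiplicity — removable singularity of `(A − iA′)/(A + iA′)`), `continuousAt_conj_upperHalfHat_conj`,
  `tendsto_hatClause2_of_lagariasXiA_eq_zero`, `tendsto_hatClause2_of_lagariasE_ne_zero`, `hatClause2_iff_of_lagariasE_ne_zero`,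
  `hatClause2_iff_of_lagariasXiA_eq_zero`;
* (v-2) ONE definition `HasHatValueR` = `HasHatValue` with clause 2 replaced by the relational text
  «`Tendsto (fun z ↦ lagariasTheta z * conj (upperHalfHat (suzukiK ψ) (conj z))) (𝓝[≠] γ) (𝓝 c)`», and the bridges
  `hasHatValueR_iff_hasHatValue` (nothing changes wherever `E_ξ(γ) ≠ 0`), `hasHatValueR_iff_of_lagariasXiA_eq_zero` (at a zero
  parameter the value is the PRINTED `−conj((𝖪ψ)^(γ̄))`), `HasHatValueR.unique`, `hasHatValueR_sub` (additivity, the only property the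
  RH-free door uses).
Sources: M. Suzuki, arXiv:2301.05779 [Su23b] §3 (Prop. 3.1 (3)⟹(2), §3.2 eq. (3.2), p. 7); M. Suzuki, CJM 2025 (`Suzuki2025WeilHilbertSpace`)
Thm. 1.3, §2.3, §3.4.  Imports Literature only.  Nothing here is a claim about the truth of RH.
-/

noncomputable section

open Set Filter Metric Complex Topology MeasureTheory
open scoped ComplexConjugate
open Literature.Analysis.DeBrangesSpaces

namespace Literature.NumberTheory.LFunctions

/-! ## (v-1) `Θ_ξ` at the zero parameters of `A` and the relational clause-2 value -/

/-- RH-FREE.  **`Θ_ξ → −1` at every zero parameter of `A`, whatever the multiplicity** (removable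
singularity of `(A − iA′)/(A + iA′)` at a zero of `A` of order `m`: both numerator and denominator are
`(z−γ)^{m−1}(∓ i m a(γ) + O(z−γ))`).  Kernel form of the printed remark «writing `ξ(1/2 − iz) = c(z−z₀)^m F(z)` …
we see `Θ(z₀) = −1`». [cite: Suzuki2023b, §3, proof of Prop. 3.1 (3)⟹(2), p. 7] -/
theorem tendsto_lagariasTheta_neg_one_of_lagariasXiA_eq_zero {γ : ℂ} (hA : lagariasXiA γ = 0) :
    Tendsto lagariasTheta (𝓝[≠] γ) (𝓝 (-1)) := by
  have hAa : AnalyticAt ℂ lagariasXiA γ := differentiable_lagariasXiA.analyticAt γ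
  have hne : ¬ ∀ᶠ z in 𝓝 γ, lagariasXiA z = 0 := by
    intro h
    have han : AnalyticOnNhd ℂ lagariasXiA univ := fun u _ => differentiable_lagariasXiA.analyticAt u
    have hzero := han.eqOn_zero_of_preconnected_of_eventuallyEq_zero isPreconnected_univ (mem_univ γ) h
    have h2 : lagariasXiA ((3 / 2 : ℂ) * I) = 0 := hzero (mem_univ _)
    rw [lagariasXiA_eq] at h2
    have h3 : (1 : ℂ) / 2 - I * ((3 / 2 : ℂ) * I) = 2 := by linear_combination (-(3 : ℂ) / 2) * I_mul_I
    rw [h3] at h2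
    exact riemannXi_ne_zero_of_one_le_re (s := 2) (by norm_num) h2
  obtain ⟨m, a, ha, ha0, hAF⟩ := hAa.exists_eventuallyEq_pow_smul_nonzero_iff.mpr hne
  have hm : m ≠ 0 := by
    rintro rfl
    have h1 := hAF.self_of_nhds
    rw [pow_zero, one_smul] at h1
    exact ha0 (h1.symm.trans hA)
  obtain ⟨k, rfl⟩ : ∃ k, m = k + 1 := ⟨m - 1, by omega⟩
  obtain ⟨ε, hε, hball⟩ := Metric.eventually_nhds_iff_ball.1 (hAF.and ha.eventually_analyticAt)
  have hderiv : ∀ z ∈ ball γ ε,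
      deriv lagariasXiA z = (z - γ) ^ k * ((k + 1) * a z + (z - γ) * deriv a z) := by
    intro z hz
    have hloc : lagariasXiA =ᶠ[𝓝 z] fun w => (w - γ) ^ (k + 1) * a w := by
      filter_upwards [isOpen_ball.mem_nhds hz] with w hw
      rw [(hball w hw).1, smul_eq_mul]
    rw [hloc.deriv_eq]
    have haz : HasDerivAt a (deriv a z) z := (hball z hz).2.differentiableAt.hasDerivAt
    have hF : HasDerivAt (fun w : ℂ => (w - γ) ^ (k + 1) * a w)
        ((((k + 1 : ℕ) : ℂ) * (z - γ) ^ (k + 1 - 1) * 1) * a z + (z - γ) ^ (k + 1) * deriv a z) z :=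
      (((hasDerivAt_id' z).sub_const γ).pow (k + 1)).mul haz
    rw [hF.deriv, Nat.add_sub_cancel]
    push_cast
    ring
  have hk1 : ((k : ℂ) + 1) ≠ 0 := by exact_mod_cast Nat.succ_ne_zero k
  have hI : I * ((k + 1) * a γ) ≠ 0 := mul_ne_zero I_ne_zero (mul_ne_zero hk1 ha0)
  -- the continuous model `g` of `Θ_ξ` near `γ`
  set g : ℂ → ℂ := fun z => ((z - γ) * a z - I * ((k + 1) * a z + (z - γ) * deriv a z)) /
      ((z - γ) * a z + I * ((k + 1) * a z + (z - γ) * deriv a z)) with hg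
  have hac : ContinuousAt a γ := ha.continuousAt
  have hdac : ContinuousAt (deriv a) γ := ha.deriv.continuousAt
  have hsub : ContinuousAt (fun z : ℂ => z - γ) γ := continuousAt_id.sub continuousAt_const
  have hX : ContinuousAt (fun z : ℂ => ((k : ℂ) + 1) * a z + (z - γ) * deriv a z) γ :=
    (continuousAt_const.mul hac).add (hsub.mul hdac)
  have hDc : ContinuousAt (fun z : ℂ => (z - γ) * a z + I * (((k : ℂ) + 1) * a z + (z - γ) * deriv a z)) γ :=
    (hsub.mul hac).add (continuousAt_const.mul hX)
  have hDγ : (γ - γ) * a γ + I * (((k : ℂ) + 1) * a γ + (γ - γ) * deriv a γ) ≠ 0 := by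
    simpa using hI
  have hDne : ∀ᶠ z in 𝓝 γ, (z - γ) * a z + I * (((k : ℂ) + 1) * a z + (z - γ) * deriv a z) ≠ 0 :=
    hDc.eventually_ne hDγ
  have hΘg : ∀ᶠ z in 𝓝[≠] γ, g z = lagariasTheta z := by
    have hb : ∀ᶠ z in 𝓝[≠] γ, (z ∈ ball γ ε ∧
        (z - γ) * a z + I * (((k : ℂ) + 1) * a z + (z - γ) * deriv a z) ≠ 0) ∧ z ≠ γ :=
      (eventually_nhdsWithin_of_eventually_nhds
        ((isOpen_ball.eventually_mem (mem_ball_self hε)).and hDne)).and eventually_mem_nhdsWithin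
    filter_upwards [hb] with z hz
    obtain ⟨⟨hzb, hzD⟩, hzγ⟩ := hz
    have hzk : (z - γ) ^ k ≠ 0 := pow_ne_zero _ (sub_ne_zero.2 hzγ)
    have hD₁ : (z - γ) ^ (k + 1) * a z +
        I * ((z - γ) ^ k * ((k + 1) * a z + (z - γ) * deriv a z)) ≠ 0 := by
      have : (z - γ) ^ (k + 1) * a z + I * ((z - γ) ^ k * ((k + 1) * a z + (z - γ) * deriv a z)) =
          (z - γ) ^ k * ((z - γ) * a z + I * (((k : ℂ) + 1) * a z + (z - γ) * deriv a z)) := by ring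
      rw [this]; exact mul_ne_zero hzk hzD
    rw [lagariasTheta_eq_div, hderiv z hzb, (hball z hzb).1, smul_eq_mul, hg]
    dsimp only
    rw [div_eq_div_iff hzD hD₁]
    ring
  have hgc : ContinuousAt g γ :=
    ((hsub.mul hac).sub (continuousAt_const.mul hX)).div hDc hDγ
  have hgγ : g γ = -1 := by
    rw [hg]; dsimp only
    simp only [sub_self, zero_mul, zero_add, zero_sub, add_zero]
    rw [neg_div, div_self hI]
  have ht : Tendsto g (𝓝[≠] γ) (𝓝 (-1)) := hgγ ▸ hgc.tendsto.mono_left nhdsWithin_le_nhds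
  exact ht.congr' hΘg

/-- RH-FREE.  `z ↦ conj(φ̂(z̄))` is continuous at every `γ ∈ ℂ₋` (`φ̂` is holomorphic on `ℂ₊`).
[cite: Suzuki2025WeilHilbertSpace, §2.3, p. 5 (H² = 𝖥(L²(0,∞)) consists of analytic functions on ℂ₊)] -/
theorem continuousAt_conj_upperHalfHat_conj (φ : Lp ℂ 2 (volume : Measure ℝ)) {γ : ℂ} (hγ : γ.im < 0) :
    ContinuousAt (fun z : ℂ ↦ conj (upperHalfHat φ (conj z))) γ := by
  have h1 : ContinuousAt (upperHalfHat φ) (conj γ) :=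
    (hasDerivAt_upperHalfHat φ (z₀ := conj γ) (by rw [conj_im]; linarith)).differentiableAt.continuousAt
  have h2 : ContinuousAt (fun z : ℂ ↦ upperHalfHat φ (conj z)) γ :=
    ContinuousAt.comp (g := upperHalfHat φ) h1 continuous_conj.continuousAt
  exact ContinuousAt.comp (g := fun w : ℂ ↦ conj w) continuous_conj.continuousAt h2

/-- RH-FREE.  **The relational clause-2 value at a zero parameter `γ ∈ ℂ₋` is the PRINTED one**,
`−conj((𝖪ψ)^(γ̄))`, whatever the multiplicity of the zero.
[cite: Suzuki2023b, §3.2, p. 7 (ψ̂(γ) = Θ(γ)·conj φ̂(γ̄), Θ = −1 at the zeros of A)] -/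
theorem tendsto_hatClause2_of_lagariasXiA_eq_zero (ψ : Lp ℂ 2 (volume : Measure ℝ)) {γ : ℂ}
    (hγ : γ.im < 0) (hA : lagariasXiA γ = 0) :
    Tendsto (fun z ↦ lagariasTheta z * conj (upperHalfHat (suzukiK ψ) (conj z))) (𝓝[≠] γ)
      (𝓝 (-conj (upperHalfHat (suzukiK ψ) (conj γ)))) := by
  have hc := (continuousAt_conj_upperHalfHat_conj (suzukiK ψ) hγ).tendsto.mono_left
    (nhdsWithin_le_nhds (s := ({γ}ᶜ : Set ℂ)))
  have := (tendsto_lagariasTheta_neg_one_of_lagariasXiA_eq_zero hA).mul hc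
  simpa using this

/-- RH-FREE.  Off `Z(E_ξ)` the relational clause-2 value is the value `Θ_ξ(γ)·conj((𝖪ψ)^(γ̄))` of
`HasHatValue` (continuity of `Θ_ξ` at `γ`). [cite: Suzuki2023b, §3.2, eq. (3.2), p. 7 (Θ = E♯/E meromorphic)] -/
theorem tendsto_hatClause2_of_lagariasE_ne_zero (ψ : Lp ℂ 2 (volume : Measure ℝ)) {γ : ℂ}
    (hγ : γ.im < 0) (hE : lagariasE γ ≠ 0) :
    Tendsto (fun z ↦ lagariasTheta z * conj (upperHalfHat (suzukiK ψ) (conj z))) (𝓝[≠] γ)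
      (𝓝 (lagariasTheta γ * conj (upperHalfHat (suzukiK ψ) (conj γ)))) := by
  have hs : Continuous (sharp lagariasE) := by
    have : sharp lagariasE = fun z => conj (lagariasE (conj z)) := rfl
    rw [this]
    exact continuous_conj.comp (continuous_lagariasE.comp continuous_conj)
  have hΘ : ContinuousAt lagariasTheta γ := by
    have : lagariasTheta = fun z => sharp lagariasE z / lagariasE z := rfl
    rw [this]
    exact hs.continuousAt.div continuous_lagariasE.continuousAt hE
  have hc := continuousAt_conj_upperHalfHat_conj (suzukiK ψ) hγ
  exact (hΘ.mul hc).tendsto.mono_left nhdsWithin_le_nhds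

/-- RH-FREE.  Wherever `E_ξ(γ) ≠ 0` (`γ ∈ ℂ₋`) the relational clause `Tendsto (…) (𝓝[≠] γ) (𝓝 c)` is
EQUIVALENT to `c = Θ_ξ(γ)·conj((𝖪ψ)^(γ̄))` (clause 2 of `HasHatValue`). [cite: Suzuki2023b, §3.2, p. 7] -/
theorem hatClause2_iff_of_lagariasE_ne_zero (ψ : Lp ℂ 2 (volume : Measure ℝ)) {γ c : ℂ}
    (hγ : γ.im < 0) (hE : lagariasE γ ≠ 0) :
    Tendsto (fun z ↦ lagariasTheta z * conj (upperHalfHat (suzukiK ψ) (conj z))) (𝓝[≠] γ) (𝓝 c) ↔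
      c = lagariasTheta γ * conj (upperHalfHat (suzukiK ψ) (conj γ)) := by
  have ht := tendsto_hatClause2_of_lagariasE_ne_zero ψ hγ hE
  constructor
  · intro h
    exact tendsto_nhds_unique h ht
  · rintro rfl; exact ht

/-- RH-FREE.  At a zero parameter `γ ∈ ℂ₋` of `A` the relational clause holds EXACTLY for the printed value
`−conj((𝖪ψ)^(γ̄))`. [cite: Suzuki2023b, §3.2, p. 7; Suzuki2025WeilHilbertSpace, Thm. 1.3, p. 3] -/
theorem hatClause2_iff_of_lagariasXiA_eq_zero (ψ : Lp ℂ 2 (volume : Measure ℝ)) {γ c : ℂ}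
    (hγ : γ.im < 0) (hA : lagariasXiA γ = 0) :
    Tendsto (fun z ↦ lagariasTheta z * conj (upperHalfHat (suzukiK ψ) (conj z))) (𝓝[≠] γ) (𝓝 c) ↔
      c = -conj (upperHalfHat (suzukiK ψ) (conj γ)) := by
  have ht := tendsto_hatClause2_of_lagariasXiA_eq_zero ψ hγ hA
  constructor
  · intro h
    exact tendsto_nhds_unique h ht
  · rintro rfl; exact ht

/-! ## (v-2) The relational hat-value evaluation `HasHatValueR` -/

/-- **Pointwise value of `ψ̂` at `γ`, relational form** (supersedes clause 2 of `HasHatValue`; clauses 1 and 3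
verbatim): `HasHatValueR ψ γ c` says that `c` IS the value `ψ̂(γ)`, by cases on `Im γ`:
* `Im γ > 0`: `c = ∫₀^∞ ψ(x)e^{iγx}dx`;
* `Im γ < 0`: `c = lim_{z → γ, z ≠ γ} Θ_ξ(z)·conj((𝖪ψ)^(z̄))` — the value at `γ` of the meromorphic continuation
  `Θ_ξ(z)·conj φ̂(z̄)` (`φ = 𝖪ψ`) with its removable singularities FILLED: wherever `E_ξ(γ) ≠ 0` this is
  `Θ_ξ(γ)·conj((𝖪ψ)^(γ̄))` (`hasHatValueR_iff_hasHatValue`), and at a zero parameter `γ` of `A` (`ξ(1/2 − iγ) = 0`,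
  ANY multiplicity) it is the printed `−conj((𝖪ψ)^(γ̄))` since `Θ_ξ → −1` there
  (`hasHatValueR_iff_of_lagariasXiA_eq_zero`) — whereas clause 2 of `HasHatValue` returns the junk `0` at a MULTIPLE
  zero parameter (`E_ξ(γ) = 0`, Lean's `Θ_ξ(γ) = 0/0`);
* `Im γ = 0`: `c` is the boundary limit of `ψ̂(γ + iy)` as `y ↓ 0`.
Each clause determines `c` uniquely when it holds (`HasHatValueR.unique`).  Divergence from print, recorded: Suzuki
writes `ψ̂(γ)` without comment (under RH all `γ` are real); for `Im γ < 0` he uses `ψ̂(z) = Θ(z)·conj φ̂(z̄)`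
([Su23b] §3.2) and evaluates `Θ = −1` at the zeros of `A`.
[cite: Suzuki2025WeilHilbertSpace, Thm. 1.3 (the values ψ̂(γ), ψ̂(γ′)), p. 3; Suzuki2023b, §3.2, p. 7] -/
def HasHatValueR (ψ : Lp ℂ 2 (volume : Measure ℝ)) (γ c : ℂ) : Prop :=
  (0 < γ.im ∧ c = upperHalfHat ψ γ) ∨
  (γ.im < 0 ∧ Tendsto (fun z ↦ lagariasTheta z * conj (upperHalfHat (suzukiK ψ) (conj z))) (𝓝[≠] γ) (𝓝 c)) ∨
  (γ.im = 0 ∧ Tendsto (fun y : ℝ ↦ upperHalfHat ψ (γ + I * y)) (𝓝[>] 0) (𝓝 c))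

/-- RH-FREE.  **Nothing changes off `Z(E_ξ)`**: if `E_ξ(γ) ≠ 0` whenever `Im γ < 0` is the case at hand, the
relational evaluation and `HasHatValue` agree. [cite: Suzuki2023b, §3.2, p. 7] -/
theorem hasHatValueR_iff_hasHatValue (ψ : Lp ℂ 2 (volume : Measure ℝ)) {γ c : ℂ}
    (hE : γ.im < 0 → lagariasE γ ≠ 0) : HasHatValueR ψ γ c ↔ HasHatValue ψ γ c := by
  unfold HasHatValueR HasHatValue
  refine or_congr Iff.rfl (or_congr ?_ Iff.rfl)
  constructor
  · rintro ⟨hγ, h⟩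
    exact ⟨hγ, (hatClause2_iff_of_lagariasE_ne_zero ψ hγ (hE hγ)).1 h⟩
  · rintro ⟨hγ, h⟩
    exact ⟨hγ, (hatClause2_iff_of_lagariasE_ne_zero ψ hγ (hE hγ)).2 h⟩

/-- RH-FREE.  **At a zero parameter `γ ∈ ℂ₋` of `A` (any multiplicity) the relational value is the printed
`−conj((𝖪ψ)^(γ̄))`.** [cite: Suzuki2023b, §3.2, p. 7; Suzuki2025WeilHilbertSpace, Thm. 1.3, p. 3] -/
theorem hasHatValueR_iff_of_lagariasXiA_eq_zero (ψ : Lp ℂ 2 (volume : Measure ℝ)) {γ c : ℂ}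
    (hγ : γ.im < 0) (hA : lagariasXiA γ = 0) :
    HasHatValueR ψ γ c ↔ c = -conj (upperHalfHat (suzukiK ψ) (conj γ)) := by
  unfold HasHatValueR
  constructor
  · rintro (⟨hγ', -⟩ | ⟨-, h⟩ | ⟨hγ', -⟩)
    · exact absurd hγ (not_lt.mpr hγ'.le)
    · exact (hatClause2_iff_of_lagariasXiA_eq_zero ψ hγ hA).1 h
    · exact absurd hγ' (ne_of_lt hγ)
  · intro hc
    exact Or.inr (Or.inl ⟨hγ, (hatClause2_iff_of_lagariasXiA_eq_zero ψ hγ hA).2 hc⟩)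

/-- RH-FREE.  The relational evaluation determines the value uniquely (T2 limits in clauses 2 and 3).
[cite: Suzuki2025WeilHilbertSpace, Thm. 1.3, p. 3] -/
theorem HasHatValueR.unique {ψ : Lp ℂ 2 (volume : Measure ℝ)} {γ c₁ c₂ : ℂ}
    (h₁ : HasHatValueR ψ γ c₁) (h₂ : HasHatValueR ψ γ c₂) : c₁ = c₂ := by
  rcases h₁ with ⟨hγ, rfl⟩ | ⟨hγ, h₁⟩ | ⟨hγ, h₁⟩
  · rcases h₂ with ⟨-, rfl⟩ | ⟨hγ', -⟩ | ⟨hγ', -⟩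
    · rfl
    · exact absurd hγ (not_lt.mpr hγ'.le)
    · exact absurd hγ' (ne_of_gt hγ)
  · rcases h₂ with ⟨hγ', -⟩ | ⟨-, h₂⟩ | ⟨hγ', -⟩
    · exact absurd hγ (not_lt.mpr hγ'.le)
    · exact tendsto_nhds_unique h₁ h₂
    · exact absurd hγ' (ne_of_lt hγ)
  · rcases h₂ with ⟨hγ', -⟩ | ⟨hγ', -⟩ | ⟨-, h₂⟩
    · exact absurd hγ (ne_of_gt hγ')
    · exact absurd hγ (ne_of_lt hγ')
    · exact tendsto_nhds_unique h₁ h₂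

/-- RH-FREE.  **Additivity of the relational evaluation** (the only property the RH-free door uses): values of
`ψ̂₁ − ψ̂₂` are differences of values (`𝖪` additive; limits subtract). Same shape as `hasHatValue_sub`.
[cite: Suzuki2025WeilHilbertSpace, §3.4, p. 7 (proof of Thm. 1.3: ψ := ψ₁ + ψ₂)] -/
theorem hasHatValueR_sub {ψ₁ ψ₂ : Lp ℂ 2 (volume : Measure ℝ)} {γ c₁ c₂ : ℂ}
    (h₁ : HasHatValueR ψ₁ γ c₁) (h₂ : HasHatValueR ψ₂ γ c₂) :
    HasHatValueR (ψ₁ - ψ₂) γ (c₁ - c₂) := by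
  rcases h₁ with ⟨hγ, rfl⟩ | ⟨hγ, h₁⟩ | ⟨hγ, h₁⟩
  · rcases h₂ with ⟨-, rfl⟩ | ⟨hγ', -⟩ | ⟨hγ', -⟩
    · exact Or.inl ⟨hγ, (upperHalfHat_sub ψ₁ ψ₂ hγ).symm⟩
    · exact absurd hγ (not_lt.mpr hγ'.le)
    · exact absurd hγ' (ne_of_gt hγ)
  · rcases h₂ with ⟨hγ', -⟩ | ⟨-, h₂⟩ | ⟨hγ', -⟩
    · exact absurd hγ (not_lt.mpr hγ'.le)
    · refine Or.inr (Or.inl ⟨hγ, ?_⟩)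
      have hz : ∀ᶠ z in 𝓝[≠] γ, 0 < (conj z).im := by
        have hc : ContinuousAt (fun z : ℂ ↦ z.im) γ := Complex.continuous_im.continuousAt
        have hev : ∀ᶠ z in 𝓝 γ, z.im < 0 := hc.eventually (gt_mem_nhds hγ)
        filter_upwards [eventually_nhdsWithin_of_eventually_nhds hev] with z hz
        rw [Complex.conj_im]; linarith
      have heq : (fun z ↦ lagariasTheta z * conj (upperHalfHat (suzukiK ↑(ψ₁ - ψ₂)) (conj z))) =ᶠ[𝓝[≠] γ]
          fun z ↦ lagariasTheta z * conj (upperHalfHat (suzukiK ψ₁) (conj z)) -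
            lagariasTheta z * conj (upperHalfHat (suzukiK ψ₂) (conj z)) := by
        filter_upwards [hz] with z hz
        rw [suzukiK_sub, upperHalfHat_sub _ _ hz, map_sub, mul_sub]
      exact (h₁.sub h₂).congr' heq.symm
    · exact absurd hγ' (ne_of_lt hγ)
  · rcases h₂ with ⟨hγ', -⟩ | ⟨hγ', -⟩ | ⟨-, h₂⟩
    · exact absurd hγ (ne_of_gt hγ')
    · exact absurd hγ (ne_of_lt hγ')
    · refine Or.inr (Or.inr ⟨hγ, ?_⟩)
      have hz : ∀ y : ℝ, 0 < y → 0 < (γ + I * y).im := by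
        intro y hy; simpa [hγ] using hy
      have heq : (fun y : ℝ ↦ upperHalfHat (↑(ψ₁ - ψ₂)) (γ + I * y)) =ᶠ[𝓝[>] 0]
          fun y ↦ upperHalfHat ψ₁ (γ + I * y) - upperHalfHat ψ₂ (γ + I * y) := by
        filter_upwards [self_mem_nhdsWithin] with y hy
        exact upperHalfHat_sub ψ₁ ψ₂ (hz y hy)
      exact (h₁.sub h₂).congr' heq.symm

end Literature.NumberTheory.LFunctions

end
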